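import Summits.AtomisticToContinuum.Crystallization.Theorems.FrustratedLawDichotomyStrainedPatchHomTermCalculus
import Summits.AtomisticToContinuum.Crystallization.Theorems.FrustratedLawDichotomyFarFieldSharp

/-!
# Term calculus of `W₄₅` in the SQUARED-LENGTH variable, regime by regime: closed forms of `φ`, `φ′`, and the curvature data (def-free)

decomp-a2c hand-2 g21, companion of `…StrainedPatchHomTermCalculus` (crux `AperiodicFrustratedLawGap`, stmt-AtomisticToContinuum-27623; CERT-DESIGN-g44
§1–§2, §4 (d)).  A (P4) leaf of the `HomFloor` certificate is checked by `…HomCentredForm.leaf_sound_box` / `…HomGram.boxSum_ge_of_gramLeaf` with, per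
lattice term, the univariate function `φ(q) = W₄₅(√q)` of the squared length `q`, ONE derivative function `φ′(q) = W₄₅′(√q)/(2√q)` (its `hd` input is
`…TermCalculus.hasDerivAt_phi45`) and a curvature constant `M` with `φ′ + M·id` monotone on the term's range `[a, b]`.  Here, for each regime of the
record potential (`s = √q`):

* pure-LJ regime `64/25 ≤ q ≤ 9`: `φ = q⁻⁶/12 − q⁻³/6`, `φ′ = −q⁻⁷/2 + q⁻⁴/2` (RATIONAL in `q`), curvature `φ″ = (7/2)q⁻⁸ − 2q⁻⁵ ≥ (7/2)b⁻⁸ − 2a⁻⁵`;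
* bump regime `0 < q ≤ 64/25`: `φ′ = −q⁻⁷/2 + q⁻⁴/2 − (3/256)·R(5s/4)` with `R(x) = P′(x)/x`, curvature bounded termwise from an enclosure `s₁ ≤ s ≤ s₂`;
* window `9 ≤ q ≤ 81/4`: `φ′ = Σₖ cₖ s⁻ᵏ` (eight monomials, `k ∈ {14,13,12,11,8,7,6,5}`), curvature bounded termwise from `s₁ ≤ s ≤ s₂`;
* beyond `81/4`: `φ = φ′ = 0`;

and in each regime ★ `monotoneOn_dphi45_<regime>`: the `hmono` input of `leaf_sound_box` from ONE rational inequality `M_regime(a, b, s₁, s₂) ≤ M`.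
(Inverse-power antitonicity is the tree's `…FarFieldSharp.inv_pow_le_inv_pow_of_le`.)  Straddling leaves glue two regimes with `…TermCalculus.monotoneOn_Icc_of_pieces` / `monotoneOn_add_mul_mono`.  All exponent bookkeeping was
checked in exact rational arithmetic before typing; Lean re-verifies every identity by `ring`.  0 sorry; no definitions; standard axioms.
`--supports stmt-AtomisticToContinuum-27623`.
-/

noncomputable section

namespace Summit.AtomisticToContinuum.Crystallization.Theorems.FrustratedLawDichotomyStrainedPatchHomTermCalculusSq

open Set
open Literature.MathematicalPhysics.StatisticalMechanics (lennardJones)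
open Summit.AtomisticToContinuum.Crystallization.Theorems.FrustratedLawDichotomySchurCut (omega₂ effPot corePot smoothstep₁ w₄₅ ω₄)
open Summit.AtomisticToContinuum.Crystallization.Theorems.FrustratedLawDichotomyStrainedPatchHomCentredForm (monotoneOn_deriv_add_mul_of_le_deriv2)
open Summit.AtomisticToContinuum.Crystallization.Theorems.FrustratedLawDichotomyStrainedPatchHomTermCalculus
open Summit.AtomisticToContinuum.Crystallization.Theorems.FrustratedLawDichotomyFarFieldSharp (inv_pow_le_inv_pow_of_le)

/-! ## §1. Square-root bookkeeping -/

/-- `V(√q) = q⁻⁶/12 − q⁻³/6` (`q ≥ 0`) — private copy of the Literature fact `LennardJonesSquaredDistance.lennardJones_sqrt` (that module has no farm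
olean at the time of writing; importing it would stall every check of this file). [folklore] -/
private theorem lennardJones_sqrt {q : ℝ} (hq : 0 ≤ q) : lennardJones (Real.sqrt q) = 1 / 12 * q⁻¹ ^ 6 - 1 / 6 * q⁻¹ ^ 3 := by
  unfold lennardJones
  have h2 : (Real.sqrt q)⁻¹ ^ 2 = q⁻¹ := by rw [inv_pow, Real.sq_sqrt hq]
  have h12 : (Real.sqrt q)⁻¹ ^ 12 = q⁻¹ ^ 6 := by rw [show (12 : ℕ) = 2 * 6 by norm_num, pow_mul, h2]
  have h6 : (Real.sqrt q)⁻¹ ^ 6 = q⁻¹ ^ 3 := by rw [show (6 : ℕ) = 2 * 3 by norm_num, pow_mul, h2]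
  rw [h12, h6]

/-- From `s₁² ≤ q` (`s₁ ≥ 0`): `s₁ ≤ √q` (private: a near-duplicate of a sieve-theory helper elsewhere in the tree). [folklore] -/
private theorem le_sqrt_of_sq_le {s₁ q : ℝ} (h1 : 0 ≤ s₁) (h : s₁ ^ 2 ≤ q) : s₁ ≤ Real.sqrt q :=
  (Real.le_sqrt h1 (le_trans (sq_nonneg _) h)).2 h

/-- From `q ≤ s₂²` (`s₂ ≥ 0`): `√q ≤ s₂` (private, same reason). [folklore] -/
private theorem sqrt_le_of_le_sq {s₂ q : ℝ} (h2 : 0 ≤ s₂) (h : q ≤ s₂ ^ 2) : Real.sqrt q ≤ s₂ :=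
  (Real.sqrt_le_left h2).2 h

/-! ## §2. The pure-LJ regime `64/25 ≤ q ≤ 9` (everything rational in `q`) -/

/-- Value: `φ(q) = q⁻⁶/12 − q⁻³/6` on `64/25 ≤ q ≤ 9`. [folklore] -/
theorem phi45_eq_lj {q : ℝ} (h1 : 64 / 25 ≤ q) (h2 : q ≤ 9) :
    effPot w₄₅ ω₄ (3 / 400) (Real.sqrt q) = 1 / 12 * q⁻¹ ^ 6 - 1 / 6 * q⁻¹ ^ 3 := by
  have hs1 : 8 / 5 ≤ Real.sqrt q := le_sqrt_of_sq_le (by norm_num) (by norm_num; linarith)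
  have hs2 : Real.sqrt q ≤ 3 := sqrt_le_of_le_sq (by norm_num) (by norm_num; linarith)
  rw [effPot45_eq_lj hs1 hs2, lennardJones_sqrt (by linarith)]

/-- Derivative: `φ′(q) = −q⁻⁷/2 + q⁻⁴/2` on the CLOSED regime `64/25 ≤ q ≤ 9`. [folklore] -/
theorem dphi45_eq_lj {q : ℝ} (h1 : 64 / 25 ≤ q) (h2 : q ≤ 9) :
    deriv (effPot w₄₅ ω₄ (3 / 400)) (Real.sqrt q) / (2 * Real.sqrt q) = -(1 / 2) * q⁻¹ ^ 7 + 1 / 2 * q⁻¹ ^ 4 := by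
  have hq : 0 < q := by linarith
  have hs : 0 < Real.sqrt q := Real.sqrt_pos.2 hq
  have hs1 : 8 / 5 ≤ Real.sqrt q := le_sqrt_of_sq_le (by norm_num) (by norm_num; linarith)
  have hs2 : Real.sqrt q ≤ 3 := sqrt_le_of_le_sq (by norm_num) (by norm_num; linarith)
  rw [deriv_effPot45_lj hs1 hs2]
  have key : ∀ s : ℝ, 0 < s → (-(s⁻¹) ^ 13 + (s⁻¹) ^ 7) / (2 * s) = -(1 / 2) * (s ^ 2)⁻¹ ^ 7 + 1 / 2 * (s ^ 2)⁻¹ ^ 4 := by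
    intro s hs; field_simp
  have := key _ hs
  rwa [Real.sq_sqrt hq.le] at this

/-- The smooth extension `G(q) = −q⁻⁷/2 + q⁻⁴/2` of the pure-LJ `φ′` has derivative `(7/2)q⁻⁸ − 2q⁻⁵` (`q ≠ 0`). [folklore] -/
theorem hasDerivAt_Glj {q : ℝ} (hq : q ≠ 0) :
    HasDerivAt (fun q : ℝ => -(1 / 2) * q⁻¹ ^ 7 + 1 / 2 * q⁻¹ ^ 4) (7 / 2 * q⁻¹ ^ 8 - 2 * q⁻¹ ^ 5) q := by
  have h1 : HasDerivAt (fun y : ℝ => y⁻¹) (-(q ^ 2)⁻¹) q := hasDerivAt_inv hq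
  refine (((h1.pow 7).const_mul (-(1 / 2) : ℝ)).add ((h1.pow 4).const_mul (1 / 2 : ℝ))).congr_deriv ?_
  push_cast; field_simp; ring

/-- Curvature bound on `[a, b] ⊂ (0, ∞)`: `(7/2)q⁻⁸ − 2q⁻⁵ ≥ (7/2)b⁻⁸ − 2a⁻⁵`. [folklore] -/
theorem curv_lj_ge {a b q : ℝ} (ha : 0 < a) (hq : q ∈ Icc a b) : 7 / 2 * b⁻¹ ^ 8 - 2 * a⁻¹ ^ 5 ≤ 7 / 2 * q⁻¹ ^ 8 - 2 * q⁻¹ ^ 5 := by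
  have h8 := inv_pow_le_inv_pow_of_le (ha.trans_le hq.1) hq.2 8
  have h5 := inv_pow_le_inv_pow_of_le ha hq.1 5
  linarith

/-- ★★ **`hmono` FOR A PURE-LJ TERM**: if `[a, b] ⊂ [64/25, 9]` and `2a⁻⁵ − (7/2)b⁻⁸ ≤ M` then `φ′ + M·id` is monotone on `[a, b]`. [folklore] -/
theorem monotoneOn_dphi45_lj {a b M : ℝ} (ha : 64 / 25 ≤ a) (hb : b ≤ 9) (hM : 2 * a⁻¹ ^ 5 - 7 / 2 * b⁻¹ ^ 8 ≤ M) :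
    MonotoneOn (fun t => deriv (effPot w₄₅ ω₄ (3 / 400)) (Real.sqrt t) / (2 * Real.sqrt t) + M * t) (Icc a b) := by
  have ha0 : 0 < a := by linarith
  have hG : MonotoneOn (fun t => (-(1 / 2) * t⁻¹ ^ 7 + 1 / 2 * t⁻¹ ^ 4) + M * t) (Icc a b) :=
    monotoneOn_deriv_add_mul_of_le_deriv2 (fun t ht => hasDerivAt_Glj (ha0.trans_le ht.1).ne')
      (fun t ht => by have := curv_lj_ge ha0 ht; linarith)
  refine hG.congr fun t ht => ?_
  simp only
  rw [dphi45_eq_lj (ha.trans ht.1) (ht.2.trans hb)]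

/-! ## §3. Beyond the range `81/4 ≤ q`: the term is identically zero -/

/-- Value: `φ(q) = 0` for `81/4 ≤ q`. [folklore] -/
theorem phi45_eq_far {q : ℝ} (h : 81 / 4 ≤ q) : effPot w₄₅ ω₄ (3 / 400) (Real.sqrt q) = 0 :=
  effPot45_eq_far (le_sqrt_of_sq_le (by norm_num) (by norm_num; linarith))

/-- Derivative: `φ′(q) = 0` for `81/4 ≤ q`. [folklore] -/
theorem dphi45_eq_far {q : ℝ} (h : 81 / 4 ≤ q) : deriv (effPot w₄₅ ω₄ (3 / 400)) (Real.sqrt q) / (2 * Real.sqrt q) = 0 := by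
  rw [deriv_effPot45_far (le_sqrt_of_sq_le (by norm_num) (by norm_num; linarith)), zero_div]

/-- ★ **`hmono` FOR A FAR TERM**: on `[a, b]` with `81/4 ≤ a`, `φ′ + M·id` is monotone for every `M ≥ 0`. [folklore] -/
theorem monotoneOn_dphi45_far {a b M : ℝ} (ha : 81 / 4 ≤ a) (hM : 0 ≤ M) :
    MonotoneOn (fun t => deriv (effPot w₄₅ ω₄ (3 / 400)) (Real.sqrt t) / (2 * Real.sqrt t) + M * t) (Icc a b) := by
  intro x hx y hy hxy
  simp only
  rw [dphi45_eq_far (ha.trans hx.1), dphi45_eq_far (ha.trans hy.1)]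
  nlinarith

/-! ## §4. The window `9 ≤ q ≤ 81/4` (monomials in `s = √q`) -/

/-- Value: `φ(q) = (q⁻⁶/12 − q⁻³/6)·(16s³ − 180q + 648s − 729)/27`, `s = √q`, on `9 ≤ q ≤ 81/4`. [folklore] -/
theorem phi45_eq_window {q : ℝ} (h1 : 9 ≤ q) (h2 : q ≤ 81 / 4) :
    effPot w₄₅ ω₄ (3 / 400) (Real.sqrt q) =
      (1 / 12 * q⁻¹ ^ 6 - 1 / 6 * q⁻¹ ^ 3) * ((16 * Real.sqrt q ^ 3 - 180 * q + 648 * Real.sqrt q - 729) / 27) := by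
  have hq : 0 ≤ q := by linarith
  have hs1 : 3 ≤ Real.sqrt q := le_sqrt_of_sq_le (by norm_num) (by norm_num; linarith)
  have hs2 : Real.sqrt q ≤ 9 / 2 := sqrt_le_of_le_sq (by norm_num) (by norm_num; linarith)
  rw [effPot45_eq_window hs1 hs2, lennardJones_sqrt hq, Real.sq_sqrt hq]

/-- Derivative: `φ′(q) = (27/2)s⁻¹⁴ − 11s⁻¹³ + (25/9)s⁻¹² − (2/9)s⁻¹¹ − (27/2)s⁻⁸ + 10s⁻⁷ − (20/9)s⁻⁶ + (4/27)s⁻⁵`, `s = √q`, on the CLOSED window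
`9 ≤ q ≤ 81/4`. [folklore] -/
theorem dphi45_eq_window {q : ℝ} (h1 : 9 ≤ q) (h2 : q ≤ 81 / 4) :
    deriv (effPot w₄₅ ω₄ (3 / 400)) (Real.sqrt q) / (2 * Real.sqrt q) =
      27 / 2 * (Real.sqrt q)⁻¹ ^ 14 - 11 * (Real.sqrt q)⁻¹ ^ 13 + 25 / 9 * (Real.sqrt q)⁻¹ ^ 12 - 2 / 9 * (Real.sqrt q)⁻¹ ^ 11 -
        27 / 2 * (Real.sqrt q)⁻¹ ^ 8 + 10 * (Real.sqrt q)⁻¹ ^ 7 - 20 / 9 * (Real.sqrt q)⁻¹ ^ 6 + 4 / 27 * (Real.sqrt q)⁻¹ ^ 5 := by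
  have hq : 0 < q := by linarith
  have hs : 0 < Real.sqrt q := Real.sqrt_pos.2 hq
  have hs1 : 3 ≤ Real.sqrt q := le_sqrt_of_sq_le (by norm_num) (by norm_num; linarith)
  have hs2 : Real.sqrt q ≤ 9 / 2 := sqrt_le_of_le_sq (by norm_num) (by norm_num; linarith)
  rw [deriv_effPot45_window hs1 hs2]
  unfold lennardJones
  field_simp
  ring

/-- The smooth extension `G(q) = Σₖ cₖ (√q)⁻ᵏ` of the window `φ′` has derivative `Σₖ (−k/2) cₖ (√q)⁻ᵏ⁻²`, i.e.
`−(189/2)s⁻¹⁶ + (143/2)s⁻¹⁵ − (50/3)s⁻¹⁴ + (11/9)s⁻¹³ + 54s⁻¹⁰ − 35s⁻⁹ + (20/3)s⁻⁸ − (10/27)s⁻⁷` (`q > 0`). [folklore] -/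
theorem hasDerivAt_Gwin {q : ℝ} (hq : 0 < q) :
    HasDerivAt (fun q : ℝ => 27 / 2 * (Real.sqrt q)⁻¹ ^ 14 - 11 * (Real.sqrt q)⁻¹ ^ 13 + 25 / 9 * (Real.sqrt q)⁻¹ ^ 12 -
        2 / 9 * (Real.sqrt q)⁻¹ ^ 11 - 27 / 2 * (Real.sqrt q)⁻¹ ^ 8 + 10 * (Real.sqrt q)⁻¹ ^ 7 - 20 / 9 * (Real.sqrt q)⁻¹ ^ 6 +
        4 / 27 * (Real.sqrt q)⁻¹ ^ 5)
      (-(189 / 2) * (Real.sqrt q)⁻¹ ^ 16 + 143 / 2 * (Real.sqrt q)⁻¹ ^ 15 - 50 / 3 * (Real.sqrt q)⁻¹ ^ 14 + 11 / 9 * (Real.sqrt q)⁻¹ ^ 13 +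
        54 * (Real.sqrt q)⁻¹ ^ 10 - 35 * (Real.sqrt q)⁻¹ ^ 9 + 20 / 3 * (Real.sqrt q)⁻¹ ^ 8 - 10 / 27 * (Real.sqrt q)⁻¹ ^ 7) q := by
  have hs : 0 < Real.sqrt q := Real.sqrt_pos.2 hq
  have h1 : HasDerivAt (fun q : ℝ => (Real.sqrt q)⁻¹) (-(Real.sqrt q ^ 2)⁻¹ * (1 / (2 * Real.sqrt q))) q :=
    (hasDerivAt_inv hs.ne').comp q (Real.hasDerivAt_sqrt hq.ne')
  refine ((((((((h1.pow 14).const_mul (27 / 2 : ℝ)).sub ((h1.pow 13).const_mul (11 : ℝ))).add ((h1.pow 12).const_mul (25 / 9 : ℝ))).sub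
    ((h1.pow 11).const_mul (2 / 9 : ℝ))).sub ((h1.pow 8).const_mul (27 / 2 : ℝ))).add ((h1.pow 7).const_mul (10 : ℝ))).sub
    ((h1.pow 6).const_mul (20 / 9 : ℝ))).add ((h1.pow 5).const_mul (4 / 27 : ℝ)) |>.congr_deriv ?_
  push_cast
  field_simp
  ring

/-- Curvature bound on `[a, b]` from an enclosure `s₁² ≤ a`, `b ≤ s₂²` (`s₁ > 0`): the window `G′` is bounded below termwise
(each `s⁻ᵏ` is antitone: positive coefficients at `s₂`, negative at `s₁`). [folklore] -/
theorem curv_window_ge {a b s₁ s₂ q : ℝ} (hs₁ : 0 < s₁) (h1 : s₁ ^ 2 ≤ a) (h2 : b ≤ s₂ ^ 2) (hs₂ : 0 ≤ s₂) (hq : q ∈ Icc a b) :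
    -(189 / 2) * s₁⁻¹ ^ 16 + 143 / 2 * s₂⁻¹ ^ 15 - 50 / 3 * s₁⁻¹ ^ 14 + 11 / 9 * s₂⁻¹ ^ 13 + 54 * s₂⁻¹ ^ 10 - 35 * s₁⁻¹ ^ 9 +
        20 / 3 * s₂⁻¹ ^ 8 - 10 / 27 * s₁⁻¹ ^ 7 ≤
      -(189 / 2) * (Real.sqrt q)⁻¹ ^ 16 + 143 / 2 * (Real.sqrt q)⁻¹ ^ 15 - 50 / 3 * (Real.sqrt q)⁻¹ ^ 14 + 11 / 9 * (Real.sqrt q)⁻¹ ^ 13 +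
        54 * (Real.sqrt q)⁻¹ ^ 10 - 35 * (Real.sqrt q)⁻¹ ^ 9 + 20 / 3 * (Real.sqrt q)⁻¹ ^ 8 - 10 / 27 * (Real.sqrt q)⁻¹ ^ 7 := by
  have hlo : s₁ ≤ Real.sqrt q := le_sqrt_of_sq_le hs₁.le (h1.trans hq.1)
  have hhi : Real.sqrt q ≤ s₂ := sqrt_le_of_le_sq hs₂ (hq.2.trans h2)
  have hs : 0 < Real.sqrt q := hs₁.trans_le hlo
  have l16 := inv_pow_le_inv_pow_of_le hs₁ hlo 16
  have l14 := inv_pow_le_inv_pow_of_le hs₁ hlo 14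
  have l9 := inv_pow_le_inv_pow_of_le hs₁ hlo 9
  have l7 := inv_pow_le_inv_pow_of_le hs₁ hlo 7
  have u15 := inv_pow_le_inv_pow_of_le hs hhi 15
  have u13 := inv_pow_le_inv_pow_of_le hs hhi 13
  have u10 := inv_pow_le_inv_pow_of_le hs hhi 10
  have u8 := inv_pow_le_inv_pow_of_le hs hhi 8
  linarith

/-- ★★ **`hmono` FOR A WINDOW TERM**: if `[a, b] ⊂ [9, 81/4]`, `s₁² ≤ a`, `b ≤ s₂²` (`s₁ > 0`, `s₂ ≥ 0`) and
`(189/2)s₁⁻¹⁶ − (143/2)s₂⁻¹⁵ + (50/3)s₁⁻¹⁴ − (11/9)s₂⁻¹³ − 54s₂⁻¹⁰ + 35s₁⁻⁹ − (20/3)s₂⁻⁸ + (10/27)s₁⁻⁷ ≤ M`, then `φ′ + M·id` is monotone on `[a, b]`.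
[folklore] -/
theorem monotoneOn_dphi45_window {a b s₁ s₂ M : ℝ} (ha : 9 ≤ a) (hb : b ≤ 81 / 4) (hs₁ : 0 < s₁) (h1 : s₁ ^ 2 ≤ a) (h2 : b ≤ s₂ ^ 2)
    (hs₂ : 0 ≤ s₂)
    (hM : 189 / 2 * s₁⁻¹ ^ 16 - 143 / 2 * s₂⁻¹ ^ 15 + 50 / 3 * s₁⁻¹ ^ 14 - 11 / 9 * s₂⁻¹ ^ 13 - 54 * s₂⁻¹ ^ 10 + 35 * s₁⁻¹ ^ 9 -
      20 / 3 * s₂⁻¹ ^ 8 + 10 / 27 * s₁⁻¹ ^ 7 ≤ M) :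
    MonotoneOn (fun t => deriv (effPot w₄₅ ω₄ (3 / 400)) (Real.sqrt t) / (2 * Real.sqrt t) + M * t) (Icc a b) := by
  have ha0 : 0 < a := by linarith
  have hG := monotoneOn_deriv_add_mul_of_le_deriv2 (M := M) (fun t ht => hasDerivAt_Gwin (ha0.trans_le ht.1))
      (fun t ht => by have := curv_window_ge hs₁ h1 h2 hs₂ ht; linarith)
  refine hG.congr fun t ht => ?_
  simp only
  rw [dphi45_eq_window (ha.trans ht.1) (ht.2.trans hb)]

/-! ## §5. The bump regime `0 < q ≤ 64/25` (LJ part rational in `q`, bump part polynomial in `x = 5√q/4`) -/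

/-- Value: `φ(q) = q⁻⁶/12 − q⁻³/6 − (3/200)·P(5√q/4)` on `0 ≤ q ≤ 64/25`. [folklore] -/
theorem phi45_eq_bump {q : ℝ} (h0 : 0 ≤ q) (h2 : q ≤ 64 / 25) :
    effPot w₄₅ ω₄ (3 / 400) (Real.sqrt q) = 1 / 12 * q⁻¹ ^ 6 - 1 / 6 * q⁻¹ ^ 3 - 3 / 200 * (1 - 11 / 6 * (5 * Real.sqrt q / 4) ^ 2 +
      33 / 16 * (5 * Real.sqrt q / 4) ^ 4 - 77 / 64 * (5 * Real.sqrt q / 4) ^ 5 + 33 / 256 * (5 * Real.sqrt q / 4) ^ 7 -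
      11 / 1024 * (5 * Real.sqrt q / 4) ^ 9 + 5 / 12288 * (5 * Real.sqrt q / 4) ^ 11) := by
  have hs2 : Real.sqrt q ≤ 8 / 5 := sqrt_le_of_le_sq (by norm_num) (by norm_num; linarith)
  rw [effPot45_eq_bump hs2, lennardJones_sqrt h0]

/-- Derivative: `φ′(q) = −q⁻⁷/2 + q⁻⁴/2 − (3/256)·R(5√q/4)`, `R(x) = P′(x)/x = −11/3 + (33/4)x² − (385/64)x³ + (231/256)x⁵ − (99/1024)x⁷ + (55/12288)x⁹`,
on the CLOSED regime `0 < q ≤ 64/25`. [folklore] -/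
theorem dphi45_eq_bump {q : ℝ} (h0 : 0 < q) (h2 : q ≤ 64 / 25) :
    deriv (effPot w₄₅ ω₄ (3 / 400)) (Real.sqrt q) / (2 * Real.sqrt q) = -(1 / 2) * q⁻¹ ^ 7 + 1 / 2 * q⁻¹ ^ 4 -
      3 / 256 * (-(11 / 3) + 33 / 4 * (5 * Real.sqrt q / 4) ^ 2 - 385 / 64 * (5 * Real.sqrt q / 4) ^ 3 + 231 / 256 * (5 * Real.sqrt q / 4) ^ 5 -
        99 / 1024 * (5 * Real.sqrt q / 4) ^ 7 + 55 / 12288 * (5 * Real.sqrt q / 4) ^ 9) := by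
  have hs : 0 < Real.sqrt q := Real.sqrt_pos.2 h0
  have hs2 : Real.sqrt q ≤ 8 / 5 := sqrt_le_of_le_sq (by norm_num) (by norm_num; linarith)
  rw [deriv_effPot45_bump hs hs2]
  have key : ∀ s : ℝ, 0 < s → ((-(s⁻¹) ^ 13 + (s⁻¹) ^ 7) - 3 / 160 * (-(11 / 3) * (5 * s / 4) + 33 / 4 * (5 * s / 4) ^ 3 -
      385 / 64 * (5 * s / 4) ^ 4 + 231 / 256 * (5 * s / 4) ^ 6 - 99 / 1024 * (5 * s / 4) ^ 8 + 55 / 12288 * (5 * s / 4) ^ 10)) / (2 * s) =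
      -(1 / 2) * (s ^ 2)⁻¹ ^ 7 + 1 / 2 * (s ^ 2)⁻¹ ^ 4 - 3 / 256 * (-(11 / 3) + 33 / 4 * (5 * s / 4) ^ 2 - 385 / 64 * (5 * s / 4) ^ 3 +
        231 / 256 * (5 * s / 4) ^ 5 - 99 / 1024 * (5 * s / 4) ^ 7 + 55 / 12288 * (5 * s / 4) ^ 9) := by
    intro s hs
    rw [div_eq_iff (by positivity)]
    field_simp
    ring
  have := key _ hs
  rwa [Real.sq_sqrt h0.le] at this

/-- The reduced bump derivative profile `R(x) = P′(x)/x` and its derivative `R′(x) = x·T(x)`,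
`T(x) = 33/2 − (1155/64)x + (1155/256)x³ − (693/1024)x⁵ + (165/4096)x⁷`. [folklore] -/
theorem hasDerivAt_bumpR_poly (x : ℝ) :
    HasDerivAt (fun x : ℝ => -(11 / 3) + 33 / 4 * x ^ 2 - 385 / 64 * x ^ 3 + 231 / 256 * x ^ 5 - 99 / 1024 * x ^ 7 + 55 / 12288 * x ^ 9)
      (x * (33 / 2 - 1155 / 64 * x + 1155 / 256 * x ^ 3 - 693 / 1024 * x ^ 5 + 165 / 4096 * x ^ 7)) x := by
  have h := (((((hasDerivAt_const x (-(11 / 3) : ℝ)).add ((hasDerivAt_pow 2 x).const_mul (33 / 4))).sub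
    ((hasDerivAt_pow 3 x).const_mul (385 / 64))).add ((hasDerivAt_pow 5 x).const_mul (231 / 256))).sub
    ((hasDerivAt_pow 7 x).const_mul (99 / 1024))).add ((hasDerivAt_pow 9 x).const_mul (55 / 12288))
  refine h.congr_deriv ?_
  push_cast; ring

/-- The smooth extension `G(q) = −q⁻⁷/2 + q⁻⁴/2 − (3/256)·R(5√q/4)` of the bump `φ′` has derivative
`(7/2)q⁻⁸ − 2q⁻⁵ − (75/8192)·T(5√q/4)` (`q > 0`; `dx/dq = 5/(8√q) = 25/(32x)`). [folklore] -/
theorem hasDerivAt_Gbump {q : ℝ} (hq : 0 < q) :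
    HasDerivAt (fun q : ℝ => -(1 / 2) * q⁻¹ ^ 7 + 1 / 2 * q⁻¹ ^ 4 -
        3 / 256 * (-(11 / 3) + 33 / 4 * (5 * Real.sqrt q / 4) ^ 2 - 385 / 64 * (5 * Real.sqrt q / 4) ^ 3 +
          231 / 256 * (5 * Real.sqrt q / 4) ^ 5 - 99 / 1024 * (5 * Real.sqrt q / 4) ^ 7 + 55 / 12288 * (5 * Real.sqrt q / 4) ^ 9))
      (7 / 2 * q⁻¹ ^ 8 - 2 * q⁻¹ ^ 5 - 75 / 8192 * (33 / 2 - 1155 / 64 * (5 * Real.sqrt q / 4) + 1155 / 256 * (5 * Real.sqrt q / 4) ^ 3 -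
        693 / 1024 * (5 * Real.sqrt q / 4) ^ 5 + 165 / 4096 * (5 * Real.sqrt q / 4) ^ 7)) q := by
  have hs : 0 < Real.sqrt q := Real.sqrt_pos.2 hq
  have h1 : HasDerivAt (fun y : ℝ => y⁻¹) (-(q ^ 2)⁻¹) q := hasDerivAt_inv hq.ne'
  have hx : HasDerivAt (fun q : ℝ => 5 * Real.sqrt q / 4) (5 * (1 / (2 * Real.sqrt q)) / 4) q :=
    ((Real.hasDerivAt_sqrt hq.ne').const_mul 5).div_const 4
  have hR := (hasDerivAt_bumpR_poly (5 * Real.sqrt q / 4)).comp q hx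
  refine ((((h1.pow 7).const_mul (-(1 / 2) : ℝ)).add ((h1.pow 4).const_mul (1 / 2 : ℝ))).sub (hR.const_mul (3 / 256 : ℝ))).congr_deriv ?_
  push_cast
  field_simp
  ring

/-- Curvature bound on `[a, b]` from an enclosure `s₁² ≤ a`, `b ≤ s₂²` (`s₁ > 0`, `s₂ ≥ 0`): the bump `G′` is bounded below termwise
(`q⁻⁸`, `q⁻⁵` antitone in `q`; the monomials `xᵏ`, `x = 5√q/4 ∈ [5s₁/4, 5s₂/4]`, monotone). [folklore] -/
theorem curv_bump_ge {a b s₁ s₂ q : ℝ} (hs₁ : 0 < s₁) (h1 : s₁ ^ 2 ≤ a) (h2 : b ≤ s₂ ^ 2) (hs₂ : 0 ≤ s₂) (hq : q ∈ Icc a b) :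
    7 / 2 * b⁻¹ ^ 8 - 2 * a⁻¹ ^ 5 - 75 / 8192 * (33 / 2 - 1155 / 64 * (5 * s₁ / 4) + 1155 / 256 * (5 * s₂ / 4) ^ 3 -
        693 / 1024 * (5 * s₁ / 4) ^ 5 + 165 / 4096 * (5 * s₂ / 4) ^ 7) ≤
      7 / 2 * q⁻¹ ^ 8 - 2 * q⁻¹ ^ 5 - 75 / 8192 * (33 / 2 - 1155 / 64 * (5 * Real.sqrt q / 4) + 1155 / 256 * (5 * Real.sqrt q / 4) ^ 3 -
        693 / 1024 * (5 * Real.sqrt q / 4) ^ 5 + 165 / 4096 * (5 * Real.sqrt q / 4) ^ 7) := by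
  have ha : 0 < a := lt_of_lt_of_le (by positivity) h1
  have hlo : s₁ ≤ Real.sqrt q := le_sqrt_of_sq_le hs₁.le (h1.trans hq.1)
  have hhi : Real.sqrt q ≤ s₂ := sqrt_le_of_le_sq hs₂ (hq.2.trans h2)
  have hx0 : 0 ≤ 5 * s₁ / 4 := by positivity
  have hxlo : 5 * s₁ / 4 ≤ 5 * Real.sqrt q / 4 := by linarith
  have hxhi : 5 * Real.sqrt q / 4 ≤ 5 * s₂ / 4 := by linarith
  have hx : 0 ≤ 5 * Real.sqrt q / 4 := hx0.trans hxlo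
  have hlj := curv_lj_ge ha hq
  have m3 := pow_le_pow_left₀ hx hxhi 3
  have m7 := pow_le_pow_left₀ hx hxhi 7
  have m5 := pow_le_pow_left₀ hx0 hxlo 5
  linarith

/-- ★★ **`hmono` FOR A BUMP TERM**: if `b ≤ 64/25`, `s₁² ≤ a`, `b ≤ s₂²` (`s₁ > 0`, `s₂ ≥ 0`) and
`2a⁻⁵ − (7/2)b⁻⁸ + (75/8192)(33/2 − (1155/64)(5s₁/4) + (1155/256)(5s₂/4)³ − (693/1024)(5s₁/4)⁵ + (165/4096)(5s₂/4)⁷) ≤ M`,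
then `φ′ + M·id` is monotone on `[a, b]`. [folklore] -/
theorem monotoneOn_dphi45_bump {a b s₁ s₂ M : ℝ} (hb : b ≤ 64 / 25) (hs₁ : 0 < s₁) (h1 : s₁ ^ 2 ≤ a) (h2 : b ≤ s₂ ^ 2) (hs₂ : 0 ≤ s₂)
    (hM : 2 * a⁻¹ ^ 5 - 7 / 2 * b⁻¹ ^ 8 + 75 / 8192 * (33 / 2 - 1155 / 64 * (5 * s₁ / 4) + 1155 / 256 * (5 * s₂ / 4) ^ 3 -
      693 / 1024 * (5 * s₁ / 4) ^ 5 + 165 / 4096 * (5 * s₂ / 4) ^ 7) ≤ M) :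
    MonotoneOn (fun t => deriv (effPot w₄₅ ω₄ (3 / 400)) (Real.sqrt t) / (2 * Real.sqrt t) + M * t) (Icc a b) := by
  have ha0 : 0 < a := lt_of_lt_of_le (by positivity) h1
  have hG := monotoneOn_deriv_add_mul_of_le_deriv2 (M := M) (fun t ht => hasDerivAt_Gbump (ha0.trans_le ht.1))
      (fun t ht => by have := curv_bump_ge hs₁ h1 h2 hs₂ ht; linarith)
  refine hG.congr fun t ht => ?_
  simp only
  rw [dphi45_eq_bump (ha0.trans_le ht.1) (ht.2.trans hb)]

end Summit.AtomisticToContinuum.Crystallization.Theorems.FrustratedLawDichotomyStrainedPatchHomTermCalculusSq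

end
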